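import Summits.HodgeConjecture.HodgeConjecture.Theorems.H413E2SWSiegelWeilCM
import Summits.HodgeConjecture.HodgeConjecture.Theorems.H413E2SWIdentityCloseFibreCMFinal
import HarnessLib

/-!
# H413 · E-2 · SW2 (iii) — THE CLOSER: the Siegel–Weil identity in Weil's range for the CM doubled pair, BINDER-FREE
# (`E2SWSiegelWeilCM.siegelWeil_weilRange_CM`, the RESERVED name of F0P4-plan (g4) 2026-08-31T05:04:09Z)

Cell `hodgecm-mathlib`, floor 0, programme P4, engine E-2, crux H413 (`stmt-HodgeConjecture-24833`, `--supports`); child line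
`Cruxes/H413/Lines/F0_E2SiegelWeilWeilRange.lean`, stub `stub_SW2iii_siegelWeil`; ruling F0P4-plan (g5) 2026-08-31T06:40:34Z «NO IMPORT CYCLE AT THE
CLOSER»: the closer is a NEW module in the namespace of ★ `Theorems/H413E2SWSiegelWeilCM.lean` (namespaces span modules; that file is NOT edited);
seat F0P4-p05 (g3).  PROOF lane: one theorem, no definition, no notation, no `sorry`.  HC_CM is proved only modulo the 7 printed citations until
rung 0 closes; nothing here is about Hodge classes.

WHAT THIS FILE DOES.  ★ `E2SWSiegelWeilCM.siegelWeil_weilRange_CM_of_fib (hFIB)` (F0P4-p06 (g3), ED. 2) is `StubSW2iii` — the Siegel–Weil identity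
`I□(Ψ) = κ · E(Ψ)` in Weil's convergence range for the CM doubled unitary pair, with the summable-section conjunct — from the ONE binder `hFIB`, the
fibrewise proportionality `∫ Θ dμ̂_b = ν(univ) · ∫ Θ dμ_b` of the theta-side and Eisenstein-side fibre measures on nonnegative compactly supported
tests ([Weil1965] Chap. VI n° 51–52, Théorème 5).  ★ `E2SWIdentityCloseFibreCMFinal.hfib_CM` (F0P4-p08 (g4) on B-p03 (g23)'s pre-flight; sockets
★ `E2SWFrameHyperplaneCM.hS3E_of_hNorm` and ★ `E2SWBorelBoundCMImpl.exists_borelBound_hBOUND_of_implementerHom` ∘ ★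
`E2SWBorelBoundLettersCM.exists_implementerHom_CM_of`) IS that binder, token for token.  Hence the binder-free closer below: its type is the
conclusion of `siegelWeil_weilRange_CM_of_fib` VERBATIM (= the `hSW` binder of PORT-A ★ `E2SiegelWeil.kernelRallisIdentityCM_of_siegelWeil`,
`StubSW2iii` of the child line unfolded over `Li1992.DoubledPair.*`), its proof one application.  Consumers: child ED. 10
`stub_SW2iii_siegelWeil := E2SWSiegelWeilCM.siegelWeil_weilRange_CM`, parent ED. 1.4, P4 line ED. 4 (S6 by name), `F0Hocc_holds`.

References: A. Weil, *Sur la formule de Siegel dans la théorie des groupes classiques*, Acta Math. 113 (1965), Chap. VI n° 51–52 Théorème 5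
pp. 75–77 [Weil1965]; J.-S. Li, *Non-vanishing theorems for the cohomology of certain arithmetic quotients*, J. reine angew. Math. 428 (1992),
(24)–(25) p. 184 [Li1992].
-/

set_option autoImplicit false

noncomputable section

-- Mathlib's measure ∕ quotient APIs are stated across semireducible wrappers; the carriers `Li1992.DoubledPair.*` unfold by `δ` (as in ★ `H413E2SWSiegelWeilCM`).
set_option backward.isDefEq.respectTransparency false
-- the cell's `Summit.HodgeConjecture.HodgeConjecture.…` namespace repeats the summit name by design (D-0017 layout)
set_option linter.dupNamespace false

namespace Summit.HodgeConjecture.HodgeConjecture.Cruxes.H413.E2SWSiegelWeilCM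

open scoped Matrix ENNReal ComplexOrder
open _root_.MeasureTheory NumberField
open Literature.RepresentationTheory.HeisenbergGroup Literature.RepresentationTheory.HeisenbergGroup.SymplecticMatrix
open Literature.NumberTheory.Weil1964 Literature.NumberTheory.Weil1965 Literature.NumberTheory.Automorphic
open Literature.NumberTheory.Weil1965.UnitaryDoubling
open Literature.NumberTheory.GelbartRogawski1991 Literature.NumberTheory.GelbartRogawski1991.UnitaryDualPair
open Literature.NumberTheory.Li1992 Literature.NumberTheory.Li1992.DoubledPair
open Summit.HodgeConjecture.HodgeConjecture.Cruxes.H413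

/-- **THE SIEGEL–WEIL IDENTITY IN WEIL'S RANGE FOR THE CM DOUBLED PAIR `(U(J_V), U(J_W ⊕ᶠ −J_W))` — `StubSW2iii` BY NAME, BINDER-FREE.**
For `F` totally real, `E/F` totally complex quadratic, `J_V = T_V ⊗ 1` definite at a complex place `τ`, `T_W = (t)`, a compatible splitting `s` of
the pair with `L²`-isometric Weil representation, and `2 < N`: there is `κ > 0` such that for every `Ψ ∈ 𝒮(𝕎□_𝔸)` the Siegel–Eisenstein section is
summable and `I□(Ψ) = κ · E(Ψ)`.  Proof: ★ `siegelWeil_weilRange_CM_of_fib` applied to ★ `E2SWIdentityCloseFibreCMFinal.hfib_CM`.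
[cite: Weil1965, Chap. VI n° 52, Théorème 5, pp. 76–77] [cite: Li1992, (24)–(25) p. 184] -/
theorem siegelWeil_weilRange_CM :
    ∀ (F E : Type) [Field F] [NumberField F] [Field E] [NumberField E] [Algebra F E]
      (c : E ≃ₐ[F] E) (N : ℕ) {n : ℕ} (e : Fin N × Fin 1 ≃ Fin n)
      {TV : Matrix (Fin N) (Fin N) F} {TW : Matrix (Fin 1) (Fin 1) F}
      [Algebra.IsQuadraticExtension F E]
      [IsTotallyReal F] [IsTotallyComplex E] (τ : E →+* ℂ) (hτ : ((TV.map (algebraMap F E)).map τ).PosDef)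
      {δ : E} (hcδ : c δ = -δ) (hδ : δ ≠ 0) {d : F}
      (hd : δ * δ = algebraMap F E d) (hV : TV.IsSymm) (hW : TW.IsSymm) (hVd : IsUnit TV.det) (hWd : IsUnit TW.det)
      [LocallyCompactSpace (UnitaryGroup.adelic F E c N (TV.map (algebraMap F E)))]
      [LocallyCompactSpace (UnitaryGroup.adelic F E c 1 (TW.map (algebraMap F E)))]
      (s : UnitaryGroup.adelicPair F E c N 1 (TV.map (algebraMap F E)) (TW.map (algebraMap F E)) →*
        adelicMpCont F (Fin n) (adelicGram F e TV TW))
      (hs : (splittingDatum F E c N 1 e (TV.map (algebraMap F E)) (TW.map (algebraMap F E)) hcδ hδ hd hV hW hVd hWd rfl rfl).IsCompatible s)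
      [CompactSpace (UnitaryGroup.adelic F E c N (TV.map (algebraMap F E)) ⧸
        (UnitaryGroup.toAdelic F E c N (TV.map (algebraMap F E))).range)]
      [CompactSpace (UnitaryGroup.adelic F E c 1 (TW.map (algebraMap F E)) ⧸
        (UnitaryGroup.toAdelic F E c 1 (TW.map (algebraMap F E))).range)]
      [MeasurableSpace (UnitaryGroup.adelic F E c N (TV.map (algebraMap F E)) ⧸
        (UnitaryGroup.toAdelic F E c N (TV.map (algebraMap F E))).range)]
      [BorelSpace (UnitaryGroup.adelic F E c N (TV.map (algebraMap F E)) ⧸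
        (UnitaryGroup.toAdelic F E c N (TV.map (algebraMap F E))).range)]
      (ν : Measure (UnitaryGroup.adelic F E c N (TV.map (algebraMap F E)) ⧸
        (UnitaryGroup.toAdelic F E c N (TV.map (algebraMap F E))).range))
      [IsFiniteMeasure ν] [ν.IsOpenPosMeasure]
      [SMulInvariantMeasure (UnitaryGroup.adelic F E c N (TV.map (algebraMap F E)))
        (UnitaryGroup.adelic F E c N (TV.map (algebraMap F E)) ⧸ (UnitaryGroup.toAdelic F E c N (TV.map (algebraMap F E))).range) ν]
      [MeasurableSpace (AdeleRing (𝓞 F) F)] [BorelSpace (AdeleRing (𝓞 F) F)]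
      (νX : Measure (Fin n → AdeleRing (𝓞 F) F)) [νX.IsAddHaarMeasure]
      (hiso : ∀ (p : UnitaryGroup.adelic F E c N (TV.map (algebraMap F E)) × UnitaryGroup.adelic F E c 1 (TW.map (algebraMap F E)))
          (Φ : piSchwartzBruhat F (Fin n)),
        ∫⁻ x, ‖((pairRep F E c N 1 e (TV.map (algebraMap F E)) (TW.map (algebraMap F E)) s) p Φ :
            (Fin n → AdeleRing (𝓞 F) F) → ℂ) x‖ₑ ^ 2 ∂νX =
          ∫⁻ x, ‖(Φ : (Fin n → AdeleRing (𝓞 F) F) → ℂ) x‖ₑ ^ 2 ∂νX),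
      2 < N →
        ∃ κ : ℝ, 0 < κ ∧ ∀ Ψ : piSchwartzBruhat F (Fin (n + n)),
          Summable (eisSection (actRat F N e TV hVd TW hWd) (ratDoubledW F E c hcδ hδ hd N e TV hV hVd TW hW hWd)
              (stabDiagRat F N e TV hVd TW hWd) (ev0 F N e TV hVd TW hWd) Ψ) ∧
          doubledThetaIntegral F E c hcδ hδ hd N e TV hV hVd TW hW hWd ν Ψ =
            (κ : ℂ) * eis (actRat F N e TV hVd TW hWd) (ratDoubledW F E c hcδ hδ hd N e TV hV hVd TW hW hWd) (stabDiagRat F N e TV hVd TW hWd) (ev0 F N e TV hVd TW hWd) Ψ :=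
  siegelWeil_weilRange_CM_of_fib E2SWIdentityCloseFibreCMFinal.hfib_CM

end Summit.HodgeConjecture.HodgeConjecture.Cruxes.H413.E2SWSiegelWeilCM

end
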